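import Summits.HodgeConjecture.HodgeConjecture.Theorems.R90S1SplitOpenCellRootBoxes
import HarnessLib

/-!
# R90-TF · S1 «Ch10-local» · split place, ROAD β — the open-orbit classes of `Ind_{Q_{2,1}}^{GL₃} σ'` factor through the
# Jacquet module `W_{u₁₀(F)}` (per-vector form of the cuspidal vanishing)

Cell `hodgecm-mathlib`, programme R90-TF, section S1, crux H413 (`stmt-HodgeConjecture-24833`), route `HCCMUnconditional`;
prover seat R90-C10-p02, socket S1#7 `R90.S1.SocketSplitInducedIrreducible`, ROAD β «BY SUPPORT OF σ», the NON-supercuspidal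
branch (all characteristics).  THEOREMS ONLY (no `def`, no instance, no notation, no `sorry`); ONE public theorem; lane
`--supports stmt-HodgeConjecture-24833`.

THE MATHEMATICS ([BernsteinZelevinskyASENS1977, Thm. 5.2, §7.1]; [Casselman1995, §6.3]).  `P = Q_{2,1} = M U_P ≤ GL₃(F)`, `σ'` smooth on
`W`, `I = Ind_P σ'`; the open cell `P w₀ N'`, `N' ≅ F²`.  The classes `[s · Φ_{K,w}]` (`s ∈ N'`, `Φ_{K,w}` a standard section, ★
`cellSection`) span the image of `I_open` in `I_{U_P}` (★ `exists_eq_sum_cellSection`), and `w ↦ [s · Φ_{K_γ, w}]` KILLS THE JACQUET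
KERNEL `⟨σ'(u₁₀ b) y - y⟩` of the Levi root group `u₁₀(F)` (`w₀ u₁₂(b) w₀⁻¹ = u₁₀(b)`): this file.  Hence `(I_open)_{U_P}` is a
quotient of `C_c^∞(F) ⊗ W_{u₁₀(F)}` — the open-orbit term `i ∘ w ∘ r` of the geometric lemma; with the diagonal action (sibling file
`R90S1SplitOpenCellDiagAction`) it yields `End_{GL₃}(n-Ind(σ ⊠ χ′)) = ℂ` for `σ` with REGULAR `u₁₀`-exponents (`R90S1SplitInducedEndScalarOfRegular`).
The proof is that of ★ `mk_restrictUnipotentGL_eq_zero_of_mem_vanishingOn_of_jacquet_root` (global case), run per vector.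
HONEST LABEL: an organ of S1#7, socket OPEN; HC_CM is proved only modulo the 7 printed citations (2 remaining named inputs:
hLiu418 = stmt-HodgeConjecture-24832, h413 = stmt-HodgeConjecture-24833) until rung 0 closes.
References: [BernsteinZelevinskyASENS1977] Bernstein–Zelevinsky, Ann. Sci. ÉNS 10 (1977), Thm. 5.2, §7.1 · [BernsteinZelevinskyRMS1976]
Russian Math. Surveys 31:3 (1976), §2.22–2.24 · [Casselman1995] Prop. 6.3.1–6.3.3.
-/

set_option autoImplicit false
set_option linter.dupNamespace false

noncomputable section

open Matrix Literature.LinearAlgebra.Matrix.DiagonalTorus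
open Literature.NumberTheory.Automorphic Literature.NumberTheory.Automorphic.Zelevinsky1980
open ValuativeRel
open Summit.HodgeConjecture.HodgeConjecture.R90.S1.SplitCell

namespace Summit.HodgeConjecture.HodgeConjecture.R90.S1

variable {F : Type*} [Field F]

/-! ## The open-orbit classes in the `U_P`-coinvariants (per vector) -/

section Coinvariants

variable [ValuativeRel F] [TopologicalSpace F] [IsNonarchimedeanLocalField F]
  {W : Type*} [AddCommGroup W] [Module ℂ W]
  (σ' : Representation ℂ ↥(standardParabolicGL F (lastBlockLabel 3)) W) (hσ' : σ'.IsSmooth)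

/-- Right translation by an element of `K` fixes the standard section `Φ_{K,w}`. [cite: BernsteinZelevinskyRMS1976, §2.22] -/
private theorem smoothIndRep_cellSection_of_mem₁
    (K : Subgroup ↥(oppositeCellRadical (K := F) (lastBlockLabel 3)))
    (hKo : IsOpen (K : Set ↥(oppositeCellRadical (K := F) (lastBlockLabel 3))))
    (hKc : IsCompact (K : Set ↥(oppositeCellRadical (K := F) (lastBlockLabel 3))))
    {k : ↥(oppositeCellRadical (K := F) (lastBlockLabel 3))} (hk : k ∈ K) (w : W) :
    Representation.smoothIndRep (standardParabolicGL F (lastBlockLabel 3)) σ' (k : GL (Fin 3) F)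
        (cellSection σ' (monotone_lastBlockLabel 3) hσ' K hKo hKc w) =
      cellSection σ' (monotone_lastBlockLabel 3) hσ' K hKo hKc w := by
  classical
  have hR : IsLeftTransversal K K ({k} : Finset ↥(oppositeCellRadical (K := F) (lastBlockLabel 3))) :=
    ⟨fun r hr => by rw [Finset.mem_singleton.1 hr]; exact hk,
      fun x hx => ⟨k, ⟨Finset.mem_singleton_self k, K.mul_mem (K.inv_mem hk) hx⟩,
        fun r hr => Finset.mem_singleton.1 hr.1⟩⟩
  have h := cellSection_eq_sum_smoothIndRep (monotone_lastBlockLabel 3) hσ' le_rfl hKo hKc hKo hKc hR w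
  rw [Finset.sum_singleton] at h
  exact h.symm

/-- **The root group moves into the vector (open orbit of the geometric lemma).** If `u₁₂(b)` normalises the
compact open `K ≤ N'`, then for `s ∈ N'` the classes of `s · Φ_{K, σ'(u₁₀ b) w}` and `s · Φ_{K, w}` in the
`U_P`-coinvariants agree: `u₁₂(b) · Φ_{K,w} = Φ_{K, σ'(u₁₀ b) w}` (`w₀ u₁₂(b) w₀⁻¹ = u₁₀(b)`), `u₁₂(b) ∈ U_P`, and
`u₁₂(b) s = u₀₂(-s₀₁ b) s u₁₂(b)` with `u₀₂ ∈ U_P`. [cite: BernsteinZelevinskyASENS1977, Thm. 5.2 (open orbit)] -/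
private theorem mk_translate_cellSection_root₁ (b : F)
    (K : Subgroup ↥(oppositeCellRadical (K := F) (lastBlockLabel 3)))
    (hKo : IsOpen (K : Set ↥(oppositeCellRadical (K := F) (lastBlockLabel 3))))
    (hKc : IsCompact (K : Set ↥(oppositeCellRadical (K := F) (lastBlockLabel 3))))
    (hK : conjSubgroup (u12_mem_reversedParabolic b) K = K)
    {s : GL (Fin 3) F} (hs : s ∈ oppositeCellRadical (K := F) (lastBlockLabel 3)) (w : W) :
    Representation.Coinvariants.mk
        (Representation.restrictUnipotentGL F (lastBlockLabel 3)
          (Representation.smoothIndRep (standardParabolicGL F (lastBlockLabel 3)) σ'))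
        (Representation.smoothIndRep (standardParabolicGL F (lastBlockLabel 3)) σ' s
          (cellSection σ' (monotone_lastBlockLabel 3) hσ' K hKo hKc
            (σ' ⟨transvectionGL (1 : Fin 3) 0 (show (1 : Fin 3) ≠ 0 by decide) b, u10_mem_standardParabolicGL b⟩ w))) =
      Representation.Coinvariants.mk
        (Representation.restrictUnipotentGL F (lastBlockLabel 3)
          (Representation.smoothIndRep (standardParabolicGL F (lastBlockLabel 3)) σ'))
        (Representation.smoothIndRep (standardParabolicGL F (lastBlockLabel 3)) σ' s
          (cellSection σ' (monotone_lastBlockLabel 3) hσ' K hKo hKc w)) := by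
  set I := Representation.smoothIndRep (standardParabolicGL F (lastBlockLabel 3)) σ' with hI
  -- `u₁₂(b) · Φ_{K,w} = Φ_{K, σ'(u₁₀ b) w}`
  have hP : (⟨permGL Fin.revPerm * transvectionGL (1 : Fin 3) 2 (show (1 : Fin 3) ≠ 2 by decide) b * (permGL Fin.revPerm)⁻¹,
        conj_mem_standardParabolicGL_of_mem_cellLeviUnipotent (lastBlockLabel 3) (u12_mem_cellLeviUnipotent b)⟩ :
          ↥(standardParabolicGL F (lastBlockLabel 3))) =
      ⟨transvectionGL (1 : Fin 3) 0 (show (1 : Fin 3) ≠ 0 by decide) b, u10_mem_standardParabolicGL b⟩ :=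
    Subtype.ext (w₀_conj_u12 b)
  have e1 : I (transvectionGL (1 : Fin 3) 2 (show (1 : Fin 3) ≠ 2 by decide) b) (cellSection σ' (monotone_lastBlockLabel 3) hσ' K hKo hKc w) =
      cellSection σ' (monotone_lastBlockLabel 3) hσ' K hKo hKc
        (σ' ⟨transvectionGL (1 : Fin 3) 0 (show (1 : Fin 3) ≠ 0 by decide) b, u10_mem_standardParabolicGL b⟩ w) := by
    rw [hI, smoothIndRep_levi_cellSection σ' (monotone_lastBlockLabel 3) hσ' K hKo hKc w (u12_mem_cellLeviUnipotent b),
      hP]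
    exact cellSection_congr (monotone_lastBlockLabel 3) hσ' hK _ _ hKo hKc _
  -- `s u₁₂(b) = u₀₂(-s₀₁ b)⁻¹ · u₁₂(b) · s`
  have e2 : s * transvectionGL (1 : Fin 3) 2 (show (1 : Fin 3) ≠ 2 by decide) b =
      (transvectionGL (0 : Fin 3) 2 (show (0 : Fin 3) ≠ 2 by decide) (-((s : Matrix (Fin 3) (Fin 3) F) 0 1 * b)))⁻¹ *
        (transvectionGL (1 : Fin 3) 2 (show (1 : Fin 3) ≠ 2 by decide) b * s) := by
    rw [u12_mul_of_mem hs b]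
    group
  rw [← e1, ← Module.End.mul_apply, ← map_mul, e2, map_mul, Module.End.mul_apply, map_mul, Module.End.mul_apply,
    hI, mk_smoothIndRep_eq_of_mem_unipotentRadicalGL σ' (Subgroup.inv_mem _ (u02_mem_unipotentRadicalGL _)),
    mk_smoothIndRep_eq_of_mem_unipotentRadicalGL σ' (u12_mem_unipotentRadicalGL b)]

/-- **Lengthening the box multiplies the class by the index.** For `v(t) ≤ 1` and `s ∈ N'`:
`[s · Φ_{K(γ,γ|t|⁻¹), w}] = [K(γ,γ|t|⁻¹) : K_γ] • [s · Φ_{K_γ, w}]` in the `U_P`-coinvariants (the cosets have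
representatives `u₀₂(a) ∈ U_P`). [cite: BernsteinZelevinskyASENS1977, Thm. 5.2 (open orbit)] -/
private theorem exists_mk_translate_cellSection_conjBox_eq_smul₁ {γ : ValueGroupWithZero F} (hγ : γ < 1) (hγ0 : γ ≠ 0)
    {t : Fˣ} (ht : valuation F (t : F) ≤ 1)
    {s : GL (Fin 3) F} (hs : s ∈ oppositeCellRadical (K := F) (lastBlockLabel 3)) (w : W) :
    ∃ N : ℕ, N ≠ 0 ∧
      Representation.Coinvariants.mk
          (Representation.restrictUnipotentGL F (lastBlockLabel 3)
            (Representation.smoothIndRep (standardParabolicGL F (lastBlockLabel 3)) σ'))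
          (Representation.smoothIndRep (standardParabolicGL F (lastBlockLabel 3)) σ' s
            (cellSection σ' (monotone_lastBlockLabel 3) hσ'
              (conjSubgroup (diagGL_mem_standardParabolicGL (⇑OrderDual.toDual ∘ revLabel (lastBlockLabel 3))
                (Function.update (1 : Fin 3 → Fˣ) 2 t))
                ((congruenceGL 3 γ).comap (oppositeCellRadical (K := F) (lastBlockLabel 3)).subtype))
              (isOpen_conjSubgroup _ (isOpen_comap_congruenceGL hγ0))
              (isCompact_conjSubgroup _ (isCompact_comap_congruenceGL γ)) w)) =
        (N : ℂ) • Representation.Coinvariants.mk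
          (Representation.restrictUnipotentGL F (lastBlockLabel 3)
            (Representation.smoothIndRep (standardParabolicGL F (lastBlockLabel 3)) σ'))
          (Representation.smoothIndRep (standardParabolicGL F (lastBlockLabel 3)) σ' s
            (cellSection σ' (monotone_lastBlockLabel 3) hσ'
              ((congruenceGL 3 γ).comap (oppositeCellRadical (K := F) (lastBlockLabel 3)).subtype)
              (isOpen_comap_congruenceGL hγ0) (isCompact_comap_congruenceGL γ) w)) := by
  classical
  set I := Representation.smoothIndRep (standardParabolicGL F (lastBlockLabel 3)) σ' with hI
  set Ks : Subgroup ↥(oppositeCellRadical (K := F) (lastBlockLabel 3)) :=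
    (congruenceGL 3 γ).comap (oppositeCellRadical (K := F) (lastBlockLabel 3)).subtype with hKs_def
  set Kt : Subgroup ↥(oppositeCellRadical (K := F) (lastBlockLabel 3)) :=
    conjSubgroup (diagGL_mem_standardParabolicGL (⇑OrderDual.toDual ∘ revLabel (lastBlockLabel 3))
      (Function.update (1 : Fin 3 → Fˣ) 2 t)) Ks with hKt_def
  have hle : Ks ≤ Kt := box_le_conjBox hγ ht
  obtain ⟨R, hR⟩ := exists_isLeftTransversal (B := Kt) (T := Ks)
    (isCompact_conjSubgroup _ (isCompact_comap_congruenceGL γ)) (isOpen_comap_congruenceGL hγ0)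
  rw [inf_eq_right.2 hle] at hR
  refine ⟨R.card, Finset.card_ne_zero.2 hR.nonempty, ?_⟩
  rw [cellSection_eq_sum_smoothIndRep (monotone_lastBlockLabel 3) hσ' hle
      (isOpen_conjSubgroup _ (isOpen_comap_congruenceGL hγ0)) (isCompact_conjSubgroup _ (isCompact_comap_congruenceGL γ))
      (isOpen_comap_congruenceGL hγ0) (isCompact_comap_congruenceGL γ) hR w,
    map_sum, map_sum]
  have hterm : ∀ ρ ∈ R,
      Representation.Coinvariants.mk (Representation.restrictUnipotentGL F (lastBlockLabel 3) I)
          (I s (I ((ρ : ↥(oppositeCellRadical (K := F) (lastBlockLabel 3))) : GL (Fin 3) F)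
            (cellSection σ' (monotone_lastBlockLabel 3) hσ' Ks (isOpen_comap_congruenceGL hγ0)
              (isCompact_comap_congruenceGL γ) w))) =
        Representation.Coinvariants.mk (Representation.restrictUnipotentGL F (lastBlockLabel 3) I)
          (I s (cellSection σ' (monotone_lastBlockLabel 3) hσ' Ks (isOpen_comap_congruenceGL hγ0)
            (isCompact_comap_congruenceGL γ) w)) := by
    intro ρ hρ
    obtain ⟨a, ρ₁, hρ₁, e⟩ := exists_u02_mul_of_mem_conjBox hγ t (hR.mem_of_mem ρ hρ)
    have e' : s * (ρ : GL (Fin 3) F) = transvectionGL (0 : Fin 3) 2 (show (0 : Fin 3) ≠ 2 by decide) a * s * (ρ₁ : GL (Fin 3) F) := by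
      rw [e, ← mul_assoc, mul_comm_of_mem_oppositeCellRadical (n := 2) hs (u0j_mem_oppositeCellRadical (show (0 : Fin 3) ≠ 2 by decide) a)]
    rw [← Module.End.mul_apply, ← map_mul, e', map_mul, map_mul, Module.End.mul_apply, Module.End.mul_apply, hI,
      smoothIndRep_cellSection_of_mem₁ σ' hσ' Ks (isOpen_comap_congruenceGL hγ0) (isCompact_comap_congruenceGL γ) hρ₁ w,
      mk_smoothIndRep_eq_of_mem_unipotentRadicalGL σ' (u02_mem_unipotentRadicalGL a)]
  rw [Finset.sum_congr rfl hterm, Finset.sum_const, ← Nat.cast_smul_eq_nsmul ℂ]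


/-- **The open-orbit classes factor through the Jacquet module `W_{u₁₀(F)}` of `σ'`** (the `W`-valued open orbit of the geometric
lemma for `(Q_{2,1}, Q_{2,1})`, per vector).  Let `σ'` be a smooth representation of `P = Q_{2,1} ≤ GL₃(F)` on `W`, `ι = u₁₀ : F → P`
the Levi root group with `w₀ u₁₂(b) w₀⁻¹ = u₁₀(b)`, `K_γ = N' ∩ K_γ` a congruence box (`0 ≠ γ < 1`) and `s ∈ N'`.  For every `w` in
the Jacquet KERNEL `⟨σ'(u₁₀ b) y - y⟩ ≤ W` the class of the translate `s · Φ_{K_γ, w}` of the standard section in the `U_P`-coinvariants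
of `Ind_P^{GL₃} σ'` vanishes: `w ↦ [s · Φ_{K_γ, w}]` factors through `W ↠ W_{u₁₀(F)}`.  (Lengthen the box in the `E₀₂`-direction
until `u₁₂(bᵢ)` normalises it for the finitely many `bᵢ` in `w = ∑ cᵢ (σ'(u₁₀ bᵢ) yᵢ - yᵢ)` — there ★ `smoothIndRep_levi_cellSection`
gives `u₁₂(b) · Φ_{K,y} = Φ_{K, σ'(u₁₀ b) y}` and `u₁₂(b), u₀₂(a) ∈ U_P` act trivially on classes — then come back by the index.)
The global case `W = ⟨σ'(u₁₀ b) y - y⟩` is ★ `mk_restrictUnipotentGL_eq_zero_of_mem_vanishingOn_of_jacquet_root`.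
[cite: BernsteinZelevinskyASENS1977, Thm. 5.2 and §7.1] [cite: Casselman1995, Prop. 6.3.1–6.3.3] -/
theorem mk_translate_cellSection_eq_zero_of_mem_jacquet_ker
    {F : Type*} [Field F] [ValuativeRel F] [TopologicalSpace F] [IsNonarchimedeanLocalField F]
    {W : Type*} [AddCommGroup W] [Module ℂ W]
    (σ' : Representation ℂ ↥(standardParabolicGL F (lastBlockLabel 3)) W) (hσ' : σ'.IsSmooth)
    (ι : Multiplicative F →* ↥(standardParabolicGL F (lastBlockLabel 3)))
    (hι : ∀ b : F, ((ι (Multiplicative.ofAdd b) : ↥(standardParabolicGL F (lastBlockLabel 3))) : GL (Fin 3) F) =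
      transvectionGL (1 : Fin 3) 0 (by decide) b)
    {γ : ValueGroupWithZero F} (hγ : γ < 1) (hγ0 : γ ≠ 0)
    {s : GL (Fin 3) F} (hs : s ∈ oppositeCellRadical (K := F) (lastBlockLabel 3))
    {w : W} (hw : w ∈ Representation.Coinvariants.ker (σ'.comp ι)) :
    Representation.Coinvariants.mk
        (Representation.restrictUnipotentGL F (lastBlockLabel 3)
          (Representation.smoothIndRep (standardParabolicGL F (lastBlockLabel 3)) σ'))
        (Representation.smoothIndRep (standardParabolicGL F (lastBlockLabel 3)) σ' s
          (cellSection σ' (monotone_lastBlockLabel 3) hσ'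
            ((congruenceGL 3 γ).comap (oppositeCellRadical (K := F) (lastBlockLabel 3)).subtype)
            (isOpen_comap_congruenceGL hγ0) (isCompact_comap_congruenceGL γ) w)) = 0 := by
  classical
  set I := Representation.smoothIndRep (standardParabolicGL F (lastBlockLabel 3)) σ' with hI
  set Ks : Subgroup ↥(oppositeCellRadical (K := F) (lastBlockLabel 3)) :=
    (congruenceGL 3 γ).comap (oppositeCellRadical (K := F) (lastBlockLabel 3)).subtype with hKs_def
  -- the long boxes `K_t = d_t K_γ d_t⁻¹` and the linear maps `Λ_t w = [s · Φ_{K_t, w}]`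
  let hd : ∀ t : Fˣ, diagGL (Fin 3) (Function.update (1 : Fin 3 → Fˣ) 2 t) ∈
      standardParabolicGL F (⇑OrderDual.toDual ∘ revLabel (lastBlockLabel 3)) := fun t =>
    diagGL_mem_standardParabolicGL _ _
  let Λ : Fˣ → W →ₗ[ℂ] (Representation.restrictUnipotentGL F (lastBlockLabel 3) I).Coinvariants := fun t =>
    Representation.Coinvariants.mk (Representation.restrictUnipotentGL F (lastBlockLabel 3) I) ∘ₗ (I s) ∘ₗ
      cellSectionₗ σ' (monotone_lastBlockLabel 3) hσ' (conjSubgroup (hd t) Ks)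
        (isOpen_conjSubgroup _ (isOpen_comap_congruenceGL hγ0)) (isCompact_conjSubgroup _ (isCompact_comap_congruenceGL γ))
  have hΛ : ∀ (t : Fˣ) (x : W), Λ t x =
      Representation.Coinvariants.mk (Representation.restrictUnipotentGL F (lastBlockLabel 3) I)
        (I s (cellSection σ' (monotone_lastBlockLabel 3) hσ' (conjSubgroup (hd t) Ks)
          (isOpen_conjSubgroup _ (isOpen_comap_congruenceGL hγ0)) (isCompact_conjSubgroup _ (isCompact_comap_congruenceGL γ)) x)) :=
    fun t x => rfl
  -- every generator `σ'(u₁₀ b) y - y` is killed by `Λ_t` as soon as `v(b t) ≤ 1`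
  have hgen : ∀ (b : F) (y : W) (t : Fˣ), valuation F (b * (t : F)) ≤ 1 →
      Λ t (σ' (ι (Multiplicative.ofAdd b)) y - y) = 0 := by
    intro b y t hbt
    have hιb : ι (Multiplicative.ofAdd b) = ⟨transvectionGL (1 : Fin 3) 0 (show (1 : Fin 3) ≠ 0 by decide) b, u10_mem_standardParabolicGL b⟩ :=
      Subtype.ext (hι b)
    rw [map_sub, hΛ, hΛ, hιb, hI,
      mk_translate_cellSection_root₁ σ' hσ' b _ _ _ (conjSubgroup_u12_conjBox hγ t hbt) hs y, sub_self]
  -- span induction: `w ↦ ∃ t, ∀ t', v t' ≤ v t → Λ_{t'} w = 0`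
  have key : ∀ x : W, x ∈ Representation.Coinvariants.ker (σ'.comp ι) →
      ∃ t : Fˣ, ∀ t' : Fˣ, valuation F (t' : F) ≤ valuation F (t : F) → Λ t' x = 0 := by
    intro x hx
    unfold Representation.Coinvariants.ker at hx
    induction hx using Submodule.span_induction with
    | mem x hx =>
      obtain ⟨⟨g, y⟩, rfl⟩ := hx
      set b : F := Multiplicative.toAdd g with hb_def
      have hg : g = Multiplicative.ofAdd b := rfl
      by_cases hb : b = 0
      · refine ⟨1, fun t' _ => ?_⟩
        show Λ t' (σ' (ι g) y - y) = 0
        rw [hg]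
        refine hgen b y t' ?_
        rw [hb, zero_mul, map_zero]
        exact zero_le_one
      · refine ⟨(Units.mk0 b hb)⁻¹, fun t' ht' => ?_⟩
        show Λ t' (σ' (ι g) y - y) = 0
        rw [hg]
        refine hgen b y t' ?_
        rw [map_mul]
        calc valuation F b * valuation F (t' : F)
            ≤ valuation F b * valuation F (((Units.mk0 b hb)⁻¹ : Fˣ) : F) := by gcongr
          _ = 1 := by rw [← map_mul, Units.val_inv_eq_inv_val, Units.val_mk0, mul_inv_cancel₀ hb, map_one]
    | zero => exact ⟨1, fun t' _ => map_zero _⟩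
    | add x y _ _ ihx ihy =>
      obtain ⟨t₁, h₁⟩ := ihx
      obtain ⟨t₂, h₂⟩ := ihy
      by_cases h : valuation F (t₁ : F) ≤ valuation F (t₂ : F)
      · exact ⟨t₁, fun t' ht' => by rw [map_add, h₁ t' ht', h₂ t' (ht'.trans h), add_zero]⟩
      · exact ⟨t₂, fun t' ht' => by rw [map_add, h₁ t' (ht'.trans (le_of_not_ge h)), h₂ t' ht', add_zero]⟩
    | smul a x _ ihx =>
      obtain ⟨t, ht⟩ := ihx
      exact ⟨t, fun t' ht' => by rw [map_smul, ht t' ht', smul_zero]⟩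
  -- conclude: take `t'` with `v t' ≤ v t` and `v t' ≤ 1`
  obtain ⟨t, ht⟩ := key w hw
  obtain ⟨t', ht't, ht'1⟩ : ∃ t' : Fˣ, valuation F (t' : F) ≤ valuation F (t : F) ∧ valuation F (t' : F) ≤ 1 := by
    by_cases h : valuation F (t : F) ≤ 1
    · exact ⟨t, le_rfl, h⟩
    · exact ⟨1, by rw [Units.val_one, map_one]; exact le_of_not_ge h, by rw [Units.val_one, map_one]⟩
  have h0 := ht t' ht't
  obtain ⟨N, hN, hN'⟩ := exists_mk_translate_cellSection_conjBox_eq_smul₁ σ' hσ' hγ hγ0 ht'1 hs w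
  rw [hΛ, hI, hN'] at h0
  exact (smul_eq_zero.1 h0).resolve_left (Nat.cast_ne_zero.2 hN)

end Coinvariants

end Summit.HodgeConjecture.HodgeConjecture.R90.S1

end
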